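import Summits.QuantumFields.BalabanUV.Beta.EriceRemainderEnclosureHistoryAutonomyComparisonAgeCompositionYoungPairMoment
import Summits.QuantumFields.BalabanUV.Beta.EriceRemainderEnclosureHistoryAutonomyComparisonAgeCompositionCascade

/-!
# EriceRemainderEnclosureHistoryAutonomyComparisonAgeCompositionSeparatedAges — (E95b) route (N), first order: THE END FOR SEPARATED PROFILES WITH ANY
# NUMBER OF AGES.  For the isotone dominated memory with floor and a profile carried by ages `a_0 < a_1 < … < a_{r−1}` (`a_0 ≥ 1`, `a_{r−1} < K`) in
# geometric separation `a_{j+1} ≥ 58·a_j`, along EVERY admissible flow, for EVERY horizon and EVERY damping of the self-consistent class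
# `g_t(1 + F_t) ≥ 1`: `0 ≤ ε ≤ e` — for EVERY `r`, whatever the total load `Σ_j x_{a_j}` (which grows like `0.61·r`).  The first END of route (N)
# with an unbounded number of loaded ages; four, five, … ages in the separated regime as corollaries.  Mechanism: (E95a) `renewal_nonneg_cascade`
# fed with the row sums ((E82a) `row_mass_le`), the caps `x ≤ 0.7072` (any age) ∕ `x ≤ 0.6142` (ages `≥ 56`) ((E94b) `load_le_of_sq`) and §1
# `old_read_variation_of_bound` — (E91a) `old_read_variation` with the targets bounded by an arbitrary `T` instead of `e_m` (same proof)

Cell `pub-balaban`, β-function sub-cell, BINDER row D4 «RemainderConst leaves for Bałaban's split» (`HOME/BINDER-OWNERS.md`; owner lineage `b2b-balaban-beta-an4`;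
this file by co-owner #2 lineage `b2b-balaban-beta-d4-p2`, generation 85), β-FLOW TEAM duty (1), FREEZE (0) honoured (def-free; nothing restated).

HONEST FRAMING (page 1, verbatim and binding).  *"Discharging BetaPertH makes Bałaban's UV stability UNCONDITIONAL — a real constructive-QFT result; it is
NOT the continuum limit and NOT the Clay problem."*  THIS FILE DISCHARGES NOTHING OF THE KIND.  Elementary real algebra ∕ real analysis about ABSTRACT
functionals on a box ]0,γ]^ℕ with displayed floors, profiles and signs, and the FIRST-ORDER renewal objects of route (N) built from them — hypotheses of a
census, not facts; the form, signs, ages and moments of Bałaban's (1.22) limit functional are NOT PRINTED ([I] p. 298; GAPS G-t4-U2-1∕-2) and NOT asserted.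
Row D4 class UNCHANGED (critical-path width 0; instance 0∕1; D4 DISCHARGE NO DATE).  HONEST DEPENDENCY: continuum YM on T⁴ ⇐ BetaPertH ∧ nine spine
estimates (0/9 proved); BetaPertH ⇐ (D1) ∧ (D4) ∧ CAP+tail; G-an2-4 gates asym, D1 and NE2/3/4.

THE POINT (README `HOME/b2b-balaban-beta-d4-p2/g85/README.md`).  The read of age `k` at the pin `m`, `O_m = c_k(m)·Σ_{q∈(m,m+k]} (Π g)·ε_q`, moves across
`d ≤ k` pins by at most `4d·c_k(m)·T` when its OWN targets `ε_q`, `q ∈ (m, m+k]`, are `≤ T` (and `ε ≥ 0` beyond `m`): `d` entering targets, and a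
coefficient drop `≤ 3d·c_k(m)∕(k+d)` on the `k − d` common ones ((E91a) `old_coeff_persist`).  This RELATIVE form is what the multiplicative cascade of
(E95a) consumes: the targets of age `a_j` are bounded by `(1+κ)` times the residual `B_{j+1}` left by the OLDER ages, not by `e_m` — so the variation
error scales with the residual it must stay below, and the recursion closes uniformly in the number of ages at the ratio `R₀ = 58` (`κ = 1∕4`, older
caps `0.6142`, youngest cap `0.7072`: `1∕4 + 4·0.6142·5∕4 = 3.321 ≤ 58·(1 − 0.6142·5∕4)·1∕4 = 3.3676`).  Uses (E95a) `renewal_nonneg_cascade`, (E94b)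
`load_le_of_sq`, (E91a) `old_read_eq`∕`old_coeff_persist`, (E82a) `kernel_entry_le`∕`row_mass_le`, (E80b) `aggregate_eq_sum` BY NAME.
NOT CLAIMED: ratios below `58` between consecutive ages (the near regimes of (E90c)∕(E91b)∕(E94)); arbitrary dampings in `]0,1]`; anything nonlinear;
anything printed — NOT B12 Thm 2, NOT BetaPertH, NOT continuum, NOT Clay.

WHAT IS PROVED ([folklore]; 0 `def`, 0 sorry).  §1 **`old_read_variation_of_bound`**.  §2 `kernel_zero_of_profile_zero`, **`aggregate_eq_sum_ages`** (the
aggregate row of a profile carried by `r` ages is the sum of their rows).  §3 **`flow_nonneg_separated_ages`** (EVERY `r`), `flow_nonneg_census_separated_ages`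
(`a_0 = 1`), **`flow_nonneg_census_four_ages_separated`** (`{1, k₂, k₃, k₄}`, `k₂ ≥ 58`, `k₃ ≥ 58k₂`, `k₄ ≥ 58k₃`).
-/
noncomputable section
open Finset

namespace Summit.QuantumFields.BalabanUV.Beta.EriceRemainderEnclosureHistoryAutonomyComparisonAgeCompositionSeparatedAges

open Literature.MathematicalPhysics.QuantumFieldTheory.Balaban1983to89
open Literature.MathematicalPhysics.QuantumFieldTheory.Balaban1983to89.T4BetaStationary
open Literature.MathematicalPhysics.QuantumFieldTheory.Balaban1983to89.T4BetaFlowWellPosed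
open Summit.QuantumFields.BalabanUV.Beta.EriceRemainderEnclosureHistoryAutonomyComparisonAgeCompositionTwoAgesOldRead
  (old_read_eq old_coeff_persist)
open Summit.QuantumFields.BalabanUV.Beta.EriceRemainderEnclosureHistoryAutonomyComparisonAgeCompositionYoungPairMoment (load_le_of_sq)
open Summit.QuantumFields.BalabanUV.Beta.EriceRemainderEnclosureHistoryAutonomyComparisonAgeCompositionYoungestTailSumFlow
  (kernel_entry_le row_mass_le)
open Summit.QuantumFields.BalabanUV.Beta.EriceRemainderEnclosureHistoryAutonomyComparisonAgeCompositionChainWiring (aggregate_eq_sum)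
open Summit.QuantumFields.BalabanUV.Beta.EriceRemainderEnclosureHistoryAutonomyComparisonAgeCompositionCascade (renewal_nonneg_cascade)

variable {B : (ℕ → ℝ) → ℝ} {γ b gIR : ℝ} {L : ℕ → ℝ} {K : ℕ} {h g : ℕ → ℝ}

/-! ## §1 The old read varies slowly — relative to its own targets -/

/-- **THE OLD READ IS A SLOWLY VARYING WINDOW AVERAGE — RELATIVE FORM.**  Along every flow, for the self-consistent damping class and an age `k`
(`0 < k < K`): if `ε ≥ 0` beyond the pin `m` and the OWN targets are bounded, `ε_q ≤ T` for `m < q ≤ m + k` (`T ≥ 0`), then for `1 ≤ d ≤ k`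
`Σ_l KL k m l·ε_{m+1+l} − Σ_l KL k (m+d) l·ε_{m+d+1+l} ≤ 4d·c_k(m)·T` — `d` entering targets cost `≤ d·c_k(m)·T`, the coefficient on the common targets
drops by at most `3d·c_k(m)∕(k+d)` ((E91a) `old_coeff_persist`), the `d` new targets of the later pin are dropped.  ((E91a) `old_read_variation` is the
case `T = e_m`.) [folklore] -/
theorem old_read_variation_of_bound (hmono : ∀ u v : ℕ → ℝ, SeqBox γ u → SeqBox γ v → (∀ j, u j ≤ v j) → B u ≤ B v) (hL : ∀ k, 0 ≤ L k)
    (hb : 0 < b) (hlo : ∀ u, SeqBox γ u → b ≤ B u) (hdom : ∀ u, SeqBox γ u → ∑ k ∈ range K, L k * u k ≤ B u) (hh : SeqBox γ h)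
    (hf : MemFlow B gIR h) (hL0 : L 0 = 0) (hg : ∀ t, 0 < g t ∧ g t ≤ 1) (hgF : ∀ t, 1 ≤ g t * (1 + ∑ k ∈ range K, L k * h (t + k) ^ 3 / 2))
    {KL : ℕ → ℕ → ℕ → ℝ}
    (hKL : ∀ k n l, KL k n l = if 0 < k ∧ k < K ∧ l < k then L k * h (n + k) ^ 3 / 2 * ∏ t ∈ Ico (n + 1 + l) (n + k + 1), g t else 0)
    {k : ℕ} (hk : 0 < k) (hkK : k < K) {m d : ℕ} (hd1 : 1 ≤ d) (hdk : d ≤ k) {ε : ℕ → ℝ} {T : ℝ} (hT : 0 ≤ T)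
    (hnn : ∀ q, m < q → 0 ≤ ε q) (hle : ∀ q, m < q → q ≤ m + k → ε q ≤ T) :
    ∑ l ∈ range K, KL k m l * ε (m + 1 + l) - ∑ l ∈ range K, KL k (m + d) l * ε (m + d + 1 + l)
      ≤ 4 * d * (L k * h (m + k) ^ 3 / 2) * T := by
  have hpos : ∀ n, 0 < h n := fun n => (hh n).1
  have hP1 : ∀ a c : ℕ, ∏ t ∈ Ico a c, g t ≤ 1 := fun a c => prod_le_one (fun t _ => (hg t).1.le) fun t _ => (hg t).2
  have hP0 : ∀ a c : ℕ, 0 ≤ ∏ t ∈ Ico a c, g t := fun a c => prod_nonneg fun t _ => (hg t).1.le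
  -- the two reads in window form; split the first window at d and re-index its far part
  rw [old_read_eq hKL hk hkK m ε, old_read_eq hKL hk hkK (m + d) ε, ← sum_range_add_sum_Ico _ hdk, sum_Ico_eq_sum_range]
  set c : ℝ := L k * h (m + k) ^ 3 / 2 with hc
  set c' : ℝ := L k * h (m + d + k) ^ 3 / 2 with hc'
  set Γ : ℝ := ∏ t ∈ Ico (m + k + 1) (m + k + 1 + d), g t with hΓ
  have hc0 : 0 ≤ c := by have := hL k; have := hpos (m + k); positivity
  have hc'0 : 0 ≤ c' := by have := hL k; have := hpos (m + d + k); positivity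
  have hkr : (0 : ℝ) < k := by exact_mod_cast hk
  have hdr : (1 : ℝ) ≤ d := by exact_mod_cast hd1
  have hdk' : (d : ℝ) ≤ k := by exact_mod_cast hdk
  -- the second read dominates its first k − d targets
  have hsub : ∑ l ∈ range (k - d), c' * (∏ t ∈ Ico (m + d + 1 + l) (m + d + k + 1), g t) * ε (m + d + 1 + l)
      ≤ ∑ l ∈ range k, c' * (∏ t ∈ Ico (m + d + 1 + l) (m + d + k + 1), g t) * ε (m + d + 1 + l) :=
    sum_le_sum_of_subset_of_nonneg (range_mono (Nat.sub_le k d)) fun l _ _ =>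
      mul_nonneg (mul_nonneg hc'0 (hP0 _ _)) (hnn (m + d + 1 + l) (by omega))
  -- on the common targets the damping product factors through Γ
  have hfac : ∀ l ∈ range (k - d), (∏ t ∈ Ico (m + d + 1 + l) (m + d + k + 1), g t)
      = (∏ t ∈ Ico (m + 1 + (d + l)) (m + k + 1), g t) * Γ := by
    intro l hl
    have hl' := mem_range.mp hl
    rw [hΓ, show m + d + 1 + l = m + 1 + (d + l) by ring, show m + d + k + 1 = m + k + 1 + d by ring]
    exact (prod_Ico_consecutive _ (by omega) (by omega)).symm
  -- bound A: the d entering targets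
  have hA : ∑ l ∈ range d, c * (∏ t ∈ Ico (m + 1 + l) (m + k + 1), g t) * ε (m + 1 + l) ≤ (d : ℝ) * (c * T) := by
    calc ∑ l ∈ range d, c * (∏ t ∈ Ico (m + 1 + l) (m + k + 1), g t) * ε (m + 1 + l) ≤ ∑ l ∈ range d, c * T := by
          refine sum_le_sum fun l hl => ?_
          have hl' := mem_range.mp hl
          have h1 := hle (m + 1 + l) (by omega) (by omega)
          have h2 := hnn (m + 1 + l) (by omega)
          calc c * (∏ t ∈ Ico (m + 1 + l) (m + k + 1), g t) * ε (m + 1 + l) ≤ c * 1 * ε (m + 1 + l) :=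
                mul_le_mul_of_nonneg_right (mul_le_mul_of_nonneg_left (hP1 _ _) hc0) h2
            _ ≤ c * T := by rw [mul_one]; exact mul_le_mul_of_nonneg_left h1 hc0
      _ = (d : ℝ) * (c * T) := by rw [sum_const, card_range, nsmul_eq_mul]
  -- bound B: the coefficient drop on the common targets
  have hpers := old_coeff_persist hmono hL hb hlo hdom hh hf hL0 hg hgF (show 1 ≤ k from hk) m d
  rw [← hc, ← hc', ← hΓ] at hpers
  have hdrop : c - c' * Γ ≤ 3 * d * c / ((k : ℝ) + d) := by
    have hkd : (0 : ℝ) < (k : ℝ) + d := by linarith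
    set s : ℝ := (k : ℝ) + d with hs
    have hx : c * (k : ℝ) ^ 3 ≤ c' * Γ * s ^ 3 := by nlinarith [hpers]
    have h1 : (c - c' * Γ) * s ≤ (c - c * (k : ℝ) ^ 3 / s ^ 3) * s := by
      have hX : c * (k : ℝ) ^ 3 / s ^ 3 ≤ c' * Γ := by rw [div_le_iff₀ (by positivity)]; exact hx
      exact mul_le_mul_of_nonneg_right (by linarith) hkd.le
    have hpoly : c * s ^ 3 - c * (k : ℝ) ^ 3 ≤ 3 * d * c * s ^ 2 := by
      have hd0 : (0 : ℝ) ≤ d := by linarith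
      rw [hs]
      nlinarith [mul_nonneg hc0 (mul_nonneg hd0 (mul_nonneg hd0 hkr.le)), mul_nonneg hc0 (pow_nonneg hd0 3)]
    have h2 : (c - c * (k : ℝ) ^ 3 / s ^ 3) * s ≤ 3 * d * c := by
      rw [show (c - c * (k : ℝ) ^ 3 / s ^ 3) * s = (c * s ^ 3 - c * (k : ℝ) ^ 3) / s ^ 2 by field_simp,
        div_le_iff₀ (by positivity)]
      exact hpoly
    rw [le_div_iff₀ hkd]
    exact h1.trans h2
  have hB : ∑ l ∈ range (k - d), c * (∏ t ∈ Ico (m + 1 + (d + l)) (m + k + 1), g t) * ε (m + 1 + (d + l))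
      - ∑ l ∈ range (k - d), c' * (∏ t ∈ Ico (m + d + 1 + l) (m + d + k + 1), g t) * ε (m + d + 1 + l)
      ≤ ((k : ℝ) - d) * (3 * d * c / ((k : ℝ) + d) * T) := by
    rw [← sum_sub_distrib]
    calc ∑ l ∈ range (k - d), (c * (∏ t ∈ Ico (m + 1 + (d + l)) (m + k + 1), g t) * ε (m + 1 + (d + l))
            - c' * (∏ t ∈ Ico (m + d + 1 + l) (m + d + k + 1), g t) * ε (m + d + 1 + l))
        ≤ ∑ l ∈ range (k - d), 3 * d * c / ((k : ℝ) + d) * T := by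
          refine sum_le_sum fun l hl => ?_
          have hl' := mem_range.mp hl
          rw [hfac l hl, show m + d + 1 + l = m + 1 + (d + l) by ring]
          have hQ0 := hP0 (m + 1 + (d + l)) (m + k + 1)
          have hQ1 := hP1 (m + 1 + (d + l)) (m + k + 1)
          have hε0 := hnn (m + 1 + (d + l)) (by omega)
          have hεe := hle (m + 1 + (d + l)) (by omega) (by omega)
          have e1 : c * (∏ t ∈ Ico (m + 1 + (d + l)) (m + k + 1), g t) * ε (m + 1 + (d + l))
              - c' * ((∏ t ∈ Ico (m + 1 + (d + l)) (m + k + 1), g t) * Γ) * ε (m + 1 + (d + l))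
              = (c - c' * Γ) * ((∏ t ∈ Ico (m + 1 + (d + l)) (m + k + 1), g t) * ε (m + 1 + (d + l))) := by ring
          rw [e1]
          have h3 : 0 ≤ 3 * d * c / ((k : ℝ) + d) := by positivity
          calc (c - c' * Γ) * ((∏ t ∈ Ico (m + 1 + (d + l)) (m + k + 1), g t) * ε (m + 1 + (d + l)))
              ≤ 3 * d * c / ((k : ℝ) + d) * ((∏ t ∈ Ico (m + 1 + (d + l)) (m + k + 1), g t) * ε (m + 1 + (d + l))) :=
                mul_le_mul_of_nonneg_right hdrop (mul_nonneg hQ0 hε0)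
            _ ≤ 3 * d * c / ((k : ℝ) + d) * T := by
                refine mul_le_mul_of_nonneg_left ?_ h3
                calc (∏ t ∈ Ico (m + 1 + (d + l)) (m + k + 1), g t) * ε (m + 1 + (d + l)) ≤ 1 * ε (m + 1 + (d + l)) :=
                      mul_le_mul_of_nonneg_right hQ1 hε0
                  _ ≤ T := by rw [one_mul]; exact hεe
      _ = ((k : ℝ) - d) * (3 * d * c / ((k : ℝ) + d) * T) := by
          rw [sum_const, card_range, nsmul_eq_mul, Nat.cast_sub hdk]
  -- assemble
  have hkd : (0 : ℝ) < (k : ℝ) + d := by linarith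
  have hfin : ((k : ℝ) - d) * (3 * d * c / ((k : ℝ) + d) * T) ≤ 3 * d * (c * T) := by
    have hq : ((k : ℝ) - d) / ((k : ℝ) + d) ≤ 1 := by rw [div_le_one hkd]; linarith
    have e1 : ((k : ℝ) - d) * (3 * d * c / ((k : ℝ) + d) * T) = ((k : ℝ) - d) / ((k : ℝ) + d) * (3 * d * (c * T)) := by
      field_simp
    rw [e1]
    have h3 : 0 ≤ 3 * d * (c * T) := by positivity
    nlinarith
  linarith [hA, hB, hsub, hfin]

/-! ## §2 The aggregate row of a profile carried by `r` ages -/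

/-- The kernel row of an age off the profile vanishes. [folklore] -/
theorem kernel_zero_of_profile_zero {KL : ℕ → ℕ → ℕ → ℝ}
    (hKL : ∀ k n l, KL k n l = if 0 < k ∧ k < K ∧ l < k then L k * h (n + k) ^ 3 / 2 * ∏ t ∈ Ico (n + 1 + l) (n + k + 1), g t else 0)
    {k : ℕ} (hLk : L k = 0) (n l : ℕ) : KL k n l = 0 := by
  rw [hKL]; split_ifs <;> simp [hLk]

/-- **THE AGGREGATE ROW IS THE SUM OF THE AGES' ROWS.**  For a profile carried by the ages `a 0 < a 1 < … < a (r−1)` (`0 < a j < K`; `L l = 0` for the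
other `l < K`): `KA 1 m l = Σ_{j<r} KL (a j) m l`. [folklore] -/
theorem aggregate_eq_sum_ages {KL KA : ℕ → ℕ → ℕ → ℝ}
    (hKL : ∀ k n l, KL k n l = if 0 < k ∧ k < K ∧ l < k then L k * h (n + k) ^ 3 / 2 * ∏ t ∈ Ico (n + 1 + l) (n + k + 1), g t else 0)
    (hKA : ∀ i m l, KA i m l = KL i m l + KA (i + 1) m l) (hKAtop : ∀ m l, KA K m l = 0) (hK : 1 ≤ K)
    {r : ℕ} {a : ℕ → ℕ} (haK : ∀ j, j < r → 0 < a j ∧ a j < K) (hainj : ∀ i j, i < r → j < r → a i = a j → i = j)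
    (hLa : ∀ l, l < K → (∀ j, j < r → l ≠ a j) → L l = 0) (m l : ℕ) : KA 1 m l = ∑ j ∈ range r, KL (a j) m l := by
  have h1 : KA 1 m l = ∑ k ∈ Ico 1 (K - 1 + 1), KL k m l :=
    aggregate_eq_sum (n := K - 1) hKA (fun m l => by rw [Nat.sub_add_cancel hK]; exact hKAtop m l) (show 1 ≤ K - 1 + 1 by omega) m l
  rw [h1, Nat.sub_add_cancel hK]
  have hsub : (range r).image a ⊆ Ico 1 K := by
    intro x hx
    obtain ⟨j, hj, rfl⟩ := mem_image.mp hx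
    have := haK j (mem_range.mp hj)
    rw [mem_Ico]; omega
  rw [← sum_subset hsub (fun x hx hxn => by
      refine kernel_zero_of_profile_zero hKL (hLa x (mem_Ico.mp hx).2 fun j hj hxj => hxn ?_) m l
      exact mem_image.mpr ⟨j, mem_range.mpr hj, hxj.symm⟩),
    sum_image (fun i hi j hj hij => hainj i j (mem_range.mp hi) (mem_range.mp hj) hij)]

/-! ## §3 The END for separated profiles with any number of ages -/

/-- **SEPARATED AGES, ANY NUMBER OF THEM: THE END ALONG EVERY FLOW — EVERY HORIZON, EVERY DAMPING OF THE SELF-CONSISTENT CLASS, WHATEVER THE TOTAL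
LOAD.**  `B` an isotone memory on the box with floor `b > 0` dominating the profile `L ≥ 0` carried by the ages `a 0, …, a (r−1)` (`r ≥ 1`, `1 ≤ a 0`,
`a (r−1) < K`, `58·a j ≤ a (j+1)`, `L l = 0` for the other `l < K`); `h` a box solution; dampings `0 < g ≤ 1` with `g_t(1 + F_t) ≥ 1`; the damped
tail-sum kernels `KL`, aggregates `KA`, reads `RA`; `e ≥ 0` non-increasing; `ε` the first-order comparison solution with zero tail beyond `N`.  THEN
`0 ≤ ε ≤ e` at every pin ((E95a) `renewal_nonneg_cascade` with `κ = 1∕4`, `s₀ = 0.7072`, `s = 0.6142`, `R₀ = 58`). [folklore] -/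
theorem flow_nonneg_separated_ages (hmono : ∀ u v : ℕ → ℝ, SeqBox γ u → SeqBox γ v → (∀ j, u j ≤ v j) → B u ≤ B v)
    (hL : ∀ k, 0 ≤ L k) (hb : 0 < b) (hlo : ∀ u, SeqBox γ u → b ≤ B u) (hdom : ∀ u, SeqBox γ u → ∑ k ∈ range K, L k * u k ≤ B u)
    (hh : SeqBox γ h) (hf : MemFlow B gIR h) (hg : ∀ t, 0 < g t ∧ g t ≤ 1)
    (hgF : ∀ t, 1 ≤ g t * (1 + ∑ k ∈ range K, L k * h (t + k) ^ 3 / 2))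
    {r : ℕ} {a : ℕ → ℕ} (hr : 1 ≤ r) (ha0 : 1 ≤ a 0) (haK : a (r - 1) < K) (hsep : ∀ j, j + 1 < r → 58 * a j ≤ a (j + 1))
    (hLa : ∀ l, l < K → (∀ j, j < r → l ≠ a j) → L l = 0)
    {N : ℕ} {KL : ℕ → ℕ → ℕ → ℝ}
    (hKL : ∀ k n l, KL k n l = if 0 < k ∧ k < K ∧ l < k then L k * h (n + k) ^ 3 / 2 * ∏ t ∈ Ico (n + 1 + l) (n + k + 1), g t else 0)
    {KA : ℕ → ℕ → ℕ → ℝ} {RA : ℕ → (ℕ → ℝ) → ℕ → ℝ}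
    (hRA : ∀ i v m, RA i v m = ∑ l ∈ range K, KA i m l * v (m + 1 + l))
    (hKA : ∀ i m l, KA i m l = KL i m l + KA (i + 1) m l) (hKAtop : ∀ m l, KA K m l = 0)
    {e ε : ℕ → ℝ} (he0 : ∀ m, 0 ≤ e m) (hea : ∀ m, e (m + 1) ≤ e m)
    (hεt : ∀ m, N < m → ε m = 0) (hεrec : ∀ m, ε m = e m - RA 1 ε m) : ∀ m, 0 ≤ ε m ∧ ε m ≤ e m := by
  have hpos : ∀ n, 0 < h n := fun n => (hh n).1
  -- the chain of ages: monotone, injective, positive, below K, older ages ≥ 58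
  have hamono : ∀ i j, i ≤ j → j < r → a i ≤ a j := by
    intro i j hij hjr
    induction j, hij using Nat.le_induction with
    | base => exact le_rfl
    | succ j _ ih => have h1 := ih (by omega); have h2 := hsep j hjr; omega
  have hapos : ∀ j, j < r → 1 ≤ a j := fun j hj => ha0.trans (hamono 0 j (Nat.zero_le j) hj)
  have hastrict : ∀ i j, i < j → j < r → a i < a j := by
    intro i j hij hjr
    have h1 := hamono i (j - 1) (by omega) (by omega)
    have h2 := hsep (j - 1) (by omega)
    have h3 := hapos (j - 1) (by omega)
    rw [Nat.sub_add_cancel (by omega)] at h2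
    omega
  have hajK : ∀ j, j < r → a j < K := fun j hj => lt_of_le_of_lt (hamono j (r - 1) (by omega) (by omega)) haK
  have haold : ∀ j, 1 ≤ j → j < r → 58 ≤ a j := by
    intro j hj hjr
    have h2 := hsep (j - 1) (by omega)
    have h3 := hapos (j - 1) (by omega)
    rw [Nat.sub_add_cancel hj] at h2
    omega
  have hainj : ∀ i j, i < r → j < r → a i = a j → i = j := by
    intro i j hi hj hij
    by_contra hne
    rcases Nat.lt_or_gt_of_ne hne with h | h
    · exact absurd hij (ne_of_lt (hastrict i j h hj))
    · exact absurd hij.symm (ne_of_lt (hastrict j i h hi))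
  have hK : 1 ≤ K := by have := hajK 0 (by omega); omega
  have hL0 : L 0 = 0 := hLa 0 (by omega) fun j hj h0 => by have := hapos j hj; omega
  -- the reads of the ages
  obtain ⟨O, hO⟩ : ∃ O : ℕ → ℕ → ℝ, ∀ j q, O j q = ∑ l ∈ range K, KL (a j) q l * ε (q + 1 + l) := ⟨_, fun _ _ => rfl⟩
  have hrec : ∀ q, ε q = e q - ∑ j ∈ range r, O j q := by
    intro q
    rw [hεrec q, hRA]
    have : ∑ l ∈ range K, KA 1 q l * ε (q + 1 + l) = ∑ j ∈ range r, O j q := by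
      simp_rw [hO, aggregate_eq_sum_ages hKL hKA hKAtop hK (fun j hj => ⟨hapos j hj, hajK j hj⟩) hainj hLa, sum_mul]
      rw [sum_comm]
    rw [this]
  refine renewal_nonneg_cascade (r := r) (N := N) (Kw := K) (R₀ := 58) (κ := 1 / 4) (s₀ := 7072 / 10000) (s := 6142 / 10000) (a := a)
    (w := fun j q l => KL (a j) q l) (c := fun j q => L (a j) * h (q + a j) ^ 3 / 2) (O := O) (e := e) (ε := ε)
    (by norm_num) (by norm_num) (by norm_num) (by norm_num) (by norm_num) hsep
    (fun j q l => (kernel_entry_le hL hh hg hKL (a j) q l).1)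
    (fun j q l hl => by rw [hKL, if_neg (by omega)])
    (fun j q => by have := hL (a j); have := hpos (q + a j); positivity)
    (fun j q hj => row_mass_le hL hh hg hKL (hajK j hj) q)
    (fun q => ?_) (fun j q hj1 hjr => ?_) hO (fun j m d T hjr hd1 hdj hT hnn hle => ?_) he0 hea hεt hrec
  · -- the youngest cap: 3k + 1 ≤ 8k·0.7072² for k ≥ 1
    have hk1 : (1 : ℝ) ≤ a 0 := by exact_mod_cast ha0
    exact load_le_of_sq hmono hL hb hlo hdom hh hf ha0 (hajK 0 (by omega)) (by norm_num) (by nlinarith) q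
  · -- the older caps: 3k + 1 ≤ 8k·0.6142² for k ≥ 56
    have hk58 : (58 : ℝ) ≤ a j := by exact_mod_cast haold j hj1 hjr
    exact load_le_of_sq hmono hL hb hlo hdom hh hf (hapos j hjr) (hajK j hjr) (by norm_num) (by nlinarith) q
  · -- the relative variation of the read of age a j
    rw [hO, hO]
    have hv := old_read_variation_of_bound hmono hL hb hlo hdom hh hf hL0 hg hgF hKL (hapos j hjr) (hajK j hjr) hd1 hdj hT hnn hle
    have e1 : 4 * (d : ℝ) * (L (a j) * h (m + a j) ^ 3 / 2) * T = 4 * (L (a j) * h (m + a j) ^ 3 / 2) * d * T := by ring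
    simpa only [e1] using hv

/-- **THE CENSUS FORM: `{1, a_1, …, a_{r−1}}` WITH `a_{j+1} ≥ 58·a_j`, EVERY `r`** (`flow_nonneg_separated_ages` with `a 0 = 1`). [folklore] -/
theorem flow_nonneg_census_separated_ages (hmono : ∀ u v : ℕ → ℝ, SeqBox γ u → SeqBox γ v → (∀ j, u j ≤ v j) → B u ≤ B v)
    (hL : ∀ k, 0 ≤ L k) (hb : 0 < b) (hlo : ∀ u, SeqBox γ u → b ≤ B u) (hdom : ∀ u, SeqBox γ u → ∑ k ∈ range K, L k * u k ≤ B u)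
    (hh : SeqBox γ h) (hf : MemFlow B gIR h) (hg : ∀ t, 0 < g t ∧ g t ≤ 1)
    (hgF : ∀ t, 1 ≤ g t * (1 + ∑ k ∈ range K, L k * h (t + k) ^ 3 / 2))
    {r : ℕ} {a : ℕ → ℕ} (hr : 1 ≤ r) (ha0 : a 0 = 1) (haK : a (r - 1) < K) (hsep : ∀ j, j + 1 < r → 58 * a j ≤ a (j + 1))
    (hLa : ∀ l, l < K → (∀ j, j < r → l ≠ a j) → L l = 0)
    {N : ℕ} {KL : ℕ → ℕ → ℕ → ℝ}
    (hKL : ∀ k n l, KL k n l = if 0 < k ∧ k < K ∧ l < k then L k * h (n + k) ^ 3 / 2 * ∏ t ∈ Ico (n + 1 + l) (n + k + 1), g t else 0)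
    {KA : ℕ → ℕ → ℕ → ℝ} {RA : ℕ → (ℕ → ℝ) → ℕ → ℝ}
    (hRA : ∀ i v m, RA i v m = ∑ l ∈ range K, KA i m l * v (m + 1 + l))
    (hKA : ∀ i m l, KA i m l = KL i m l + KA (i + 1) m l) (hKAtop : ∀ m l, KA K m l = 0)
    {e ε : ℕ → ℝ} (he0 : ∀ m, 0 ≤ e m) (hea : ∀ m, e (m + 1) ≤ e m)
    (hεt : ∀ m, N < m → ε m = 0) (hεrec : ∀ m, ε m = e m - RA 1 ε m) : ∀ m, 0 ≤ ε m ∧ ε m ≤ e m :=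
  flow_nonneg_separated_ages hmono hL hb hlo hdom hh hf hg hgF hr (by rw [ha0]) haK hsep hLa hKL hRA hKA hKAtop he0 hea hεt hεrec

/-- **THE CENSUS FOUR AGES `{1, k₂, k₃, k₄}` IN THE SEPARATED REGIME** (`k₂ ≥ 58`, `k₃ ≥ 58k₂`, `k₄ ≥ 58k₃`, `k₄ < K`): `0 ≤ ε ≤ e` at every pin, every
horizon, every damping of the self-consistent class — the first four-age END of route (N). [folklore] -/
theorem flow_nonneg_census_four_ages_separated (hmono : ∀ u v : ℕ → ℝ, SeqBox γ u → SeqBox γ v → (∀ j, u j ≤ v j) → B u ≤ B v)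
    (hL : ∀ k, 0 ≤ L k) (hb : 0 < b) (hlo : ∀ u, SeqBox γ u → b ≤ B u) (hdom : ∀ u, SeqBox γ u → ∑ k ∈ range K, L k * u k ≤ B u)
    (hh : SeqBox γ h) (hf : MemFlow B gIR h) (hg : ∀ t, 0 < g t ∧ g t ≤ 1)
    (hgF : ∀ t, 1 ≤ g t * (1 + ∑ k ∈ range K, L k * h (t + k) ^ 3 / 2))
    {k₂ k₃ k₄ : ℕ} (hk2 : 58 ≤ k₂) (hk3 : 58 * k₂ ≤ k₃) (hk4 : 58 * k₃ ≤ k₄) (hk4K : k₄ < K)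
    (hL4 : ∀ j, j < K → j ≠ 1 → j ≠ k₂ → j ≠ k₃ → j ≠ k₄ → L j = 0)
    {N : ℕ} {KL : ℕ → ℕ → ℕ → ℝ}
    (hKL : ∀ k n l, KL k n l = if 0 < k ∧ k < K ∧ l < k then L k * h (n + k) ^ 3 / 2 * ∏ t ∈ Ico (n + 1 + l) (n + k + 1), g t else 0)
    {KA : ℕ → ℕ → ℕ → ℝ} {RA : ℕ → (ℕ → ℝ) → ℕ → ℝ}
    (hRA : ∀ i v m, RA i v m = ∑ l ∈ range K, KA i m l * v (m + 1 + l))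
    (hKA : ∀ i m l, KA i m l = KL i m l + KA (i + 1) m l) (hKAtop : ∀ m l, KA K m l = 0)
    {e ε : ℕ → ℝ} (he0 : ∀ m, 0 ≤ e m) (hea : ∀ m, e (m + 1) ≤ e m)
    (hεt : ∀ m, N < m → ε m = 0) (hεrec : ∀ m, ε m = e m - RA 1 ε m) : ∀ m, 0 ≤ ε m ∧ ε m ≤ e m := by
  refine flow_nonneg_census_separated_ages hmono hL hb hlo hdom hh hf hg hgF (r := 4)
    (a := fun j => if j = 0 then 1 else if j = 1 then k₂ else if j = 2 then k₃ else k₄) (by norm_num) (by simp) (by simpa using hk4K)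
    (fun j hj => ?_) (fun l hl hla => hL4 l hl ?_ ?_ ?_ ?_) hKL hRA hKA hKAtop he0 hea hεt hεrec
  · have : j = 0 ∨ j = 1 ∨ j = 2 := by omega
    rcases this with rfl | rfl | rfl <;> simp <;> omega
  · simpa using hla 0 (by norm_num)
  · simpa using hla 1 (by norm_num)
  · simpa using hla 2 (by norm_num)
  · simpa using hla 3 (by norm_num)

end Summit.QuantumFields.BalabanUV.Beta.EriceRemainderEnclosureHistoryAutonomyComparisonAgeCompositionSeparatedAges

end
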